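import Summits.AnomalousDissipation.AnomalousDissipation.Theorems.BaireTransferDenseLoudLerayHopfForcesSequential
import Summits.AnomalousDissipation.AnomalousDissipation.Theorems.BaireTransferDenseLoudLerayHopfForcesReductions
import Literature.Analysis.FunctionSpaces.BesovDifference
import Mathlib.Topology.UniformSpace.HeineCantor
import Mathlib.Topology.MetricSpace.Thickening
import HarnessLib

/-!
# Strategist census, REDIRECT r1 — checked certificates (crux `BaireTransfer.DenseLoudDesignerForces`, stmt-AnomalousDissipation-1143)

Companion of `Cruxes/DenseLoudDesignerForces/STRATEGY-CENSUS.md` (crux-strategist redirect r1, seat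
`planner-cstrat-stmt-AnomalousDissipation-1143-r1-0`, 2026-08-17).  The earlier companions keep their objects
(`StrategistCensus.lean`, p1: S⁺₁ steady, D1 = 1′/N/D, D2; `StrategistCensusS1.lean`, s1: `L_∞`, D8, S⁺_τ); this file
adds, all sorry-free:

* §C THE SUMMIT-STRENGTH CERTIFICATE (for the tribunal).  `LoudAt` (one force, one viscosity) and the sequential form
  of the crux: `DenseLoudDesignerForces ↔ ConvergentDesignPeriodicZerothLaw` — through EVERY point `c⋆` of a window pass
  designer forces `c_j → c⋆` (in the fixed finite-dimensional family `P_S`), viscosities `ν_j → 0` and loud bounded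
  time-periodic classical orbits of `NS_{ν_j}(f_{c_j})`.  The forces then converge UNIFORMLY on `T³`
  (`tendstoUniformly_force`; indeed in every `C^k`, `P_S` being finite-dimensional).  If for ONE `c⋆` the design can be
  FROZEN (`c_j = c⋆`), that is the summit (`anomalousDissipation_of_constantDesign`); the exact residual between crux and
  summit is therefore the `FreezingPrinciple` (asymptotic force-stability of loud bounded dynamics), and
  `anomalousDissipation_of_crux_of_freezing : crux → FreezingPrinciple → AnomalousDissipation`.  Read with the landed
  `denseLoudLerayHopfForces_of_denseLoudDesignerForces` / `denseLoudLerayHopfForces_iff_convergentForces`: the crux is the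
  zeroth law of turbulence (periodic-witness form, which implies the summit: CoherentStates assembly 0437) with the single
  steady force replaced by a sequence of steady forces converging to it uniformly with all derivatives inside a fixed
  finite-dimensional space of trigonometric polynomials.
* §D13 DECOMPOSITION "thin family ∧ uniform persistence" (typed and glued): `ThinFamilyLoud` (loud members dense INSIDE some
  non-empty anchor family `A ⊆ P_S` at every level — for `A` open this is the crux, certified necessary; for `A` a symmetric
  or explicit slice it is the crux on that slice) and `UniformPersistence` (a force-robustness radius of loudness UNIFORM in
  the level, budgets relaxed by 2), with the glue `denseLoudDesignerForces_of_thin_of_uniformPersistence` (thickening of the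
  anchor family).  It certifies the remark that symmetric/explicit loud families can serve the crux ONLY through a
  ν-uniform robustness radius.
* §S⁺_σ STRENGTHEN "uniformly Onsager-bounded witnesses" (typed, adapter proved): `onsagerLoudSet`,
  `DenseLoudOnsagerBoundedForces σ` — the crux with witnesses bounded in `B^σ_{3,∞}` uniformly in time and in the level — and
  `denseLoudDesignerForces_of_onsagerBounded`.  For `σ > 1/3` the class is empty at large levels by the landed Drivas–Eyink
  barrier (`Literature.Barriers.AnomalousDissipation.DrivasEyink2019_noAnomalousDissipation`; prose in the census), for
  `σ ≤ 1/3` it buys compactness of witness families and nothing constructive.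

Nothing is asserted: every `def` is a `Prop` or a `Set`, every theorem is an implication or an `Iff`.  No `sorry`.
-/

noncomputable section

set_option linter.dupNamespace false

namespace Summit.AnomalousDissipation.AnomalousDissipation.Cruxes.DenseLoudDesignerForces.StrategistCensusR1

open scoped Topology NNReal ENNReal
open Filter Set MeasureTheory
open Literature.Analysis.FunctionSpaces Literature.Analysis.FluidPDE
open Summit.AnomalousDissipation.AnomalousDissipation.Theses.BaireTransfer
open Summit.AnomalousDissipation.AnomalousDissipation.Theorems.DenseLoudDesignerForces.Negative
open Summit.AnomalousDissipation.AnomalousDissipation.Theorems.DenseLoudLerayHopfForces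

/-- Complex Fourier coefficient values. -/
local notation "ℂ³" => EuclideanSpace ℂ (Fin 3)
/-- The flat unit torus. -/
local notation "𝕋³" => UnitAddTorus (Fin 3)
/-- Velocity values. -/
local notation "ℝ³" => EuclideanSpace ℝ (Fin 3)

variable {S : Finset (Fin 3 → ℤ)} {E ε : ℝ}

/-! ## §C  The summit-strength certificate: the crux in the shape of the summit -/

/-- `LoudAt S E ε ν c`: the steady designer force `f_c` carries, AT VISCOSITY `ν`, a `τ`-periodic (`τ > 0`) classical
NS solution on `ℝ × T³` with `meanEnergy ≤ E` and `meanDissipation ν ≥ ε` (verbatim the inner clause of the crux). -/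
def LoudAt (S : Finset (Fin 3 → ℤ)) (E ε ν : ℝ) (c : ↥S → ℂ³) : Prop :=
  ∃ (τ : ℝ) (u : ℝ → 𝕋³ → ℝ³) (p : ℝ → 𝕋³ → ℝ), 0 < τ ∧
    Torus.IsClassicalNSSolutionOn Set.univ ν (fun _ => force S c) u p ∧
    Function.Periodic u τ ∧ meanEnergy u ≤ E ∧ ε ≤ meanDissipation ν u

/-- The loud sets are the level sets of `LoudAt` (definitional). -/
theorem loudSet_eq_levels (S : Finset (Fin 3 → ℤ)) (E ε : ℝ) (j : ℕ) :
    loudSet S E ε j = {c | ∃ ν : ℝ, 0 < ν ∧ ν < 1 / ((j : ℝ) + 1) ∧ LoudAt S E ε ν c} := rfl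

/-- **CONVERGENT-DESIGN PERIODIC ZEROTH LAW** — the crux written as the summit is written.  For every stock `S₀` there are
`S ⊇ S₀`, budgets `E`, `ε > 0` and a non-empty open `U ⊆ P_S` such that through EVERY `c⋆ ∈ U` pass designer forces
`c_j → c⋆` in `P_S`, viscosities `ν_j > 0`, `ν_j → 0`, and `τ_j`-periodic classical solutions `u_j` of
`NS_{ν_j}(f_{c_j})` with `⟨‖u_j‖²⟩ ≤ E` and `⟨ν_j‖∇u_j‖²⟩ ≥ ε`.  Compare `Literature.Turb.ZerothLaw` (= the summit) and
the CoherentStates thesis (stmt-0218, periodic classical witnesses, which implies the summit): the same clause list with the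
ONE force `f` replaced by `f_{c_j}`, `c_j → c⋆`. -/
def ConvergentDesignPeriodicZerothLaw : Prop :=
  ∀ S₀ : Finset (Fin 3 → ℤ), ∃ S : Finset (Fin 3 → ℤ), S₀ ⊆ S ∧ ∃ (E ε : ℝ), 0 < ε ∧
    ∃ U : Set (↥S → ℂ³), IsOpen U ∧ U.Nonempty ∧
      ∀ c₀ ∈ U, ∃ (c : ℕ → (↥S → ℂ³)) (ν : ℕ → ℝ),
        Tendsto c atTop (𝓝 c₀) ∧ (∀ j, 0 < ν j) ∧ Tendsto ν atTop (𝓝 0) ∧ ∀ j, LoudAt S E ε (ν j) (c j)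

/-- **The crux IS the convergent-design periodic zeroth law** (antitonicity of the loud sets in the level turns "dense at
every level" into "one diagonal sequence through every window point"; `forall_mem_closure_levels_iff`). -/
theorem denseLoudDesignerForces_iff_convergentDesign :
    DenseLoudDesignerForces ↔ ConvergentDesignPeriodicZerothLaw := by
  rw [denseLoudDesignerForces_iff]
  refine forall_congr' fun S₀ => exists_congr fun S => and_congr_right fun _ => exists_congr fun E =>
    exists_congr fun ε => and_congr_right fun _ => exists_congr fun U => ?_
  unfold IsWindow
  refine and_congr_right fun _ => and_congr_right fun _ => ?_
  have hL : ∀ j : ℕ, loudSet S E ε j = {y | ∃ ν : ℝ, 0 < ν ∧ ν < 1 / ((j : ℝ) + 1) ∧ LoudAt S E ε ν y} :=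
    fun j => rfl
  constructor
  · intro h c₀ hc₀
    have h' : ∀ j : ℕ, c₀ ∈ closure {y | ∃ ν : ℝ, 0 < ν ∧ ν < 1 / ((j : ℝ) + 1) ∧ LoudAt S E ε ν y} :=
      fun j => hL j ▸ h j hc₀
    exact (forall_mem_closure_levels_iff (LoudAt S E ε) c₀).1 h'
  · intro h j c₀ hc₀
    rw [hL j]
    exact (forall_mem_closure_levels_iff (LoudAt S E ε) c₀).2 (h c₀ hc₀) j

/-- **The designer forces of a convergent design converge UNIFORMLY on the torus** (joint continuity of `(c, x) ↦ f_c(x)`,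
`continuous_force_uncurry`, compactness of `T³`, local compactness of `P_S`).  Since `c ↦ f_c` is linear on the
finite-dimensional `P_S`, the same holds for every derivative: the crux's designer freedom is an arbitrarily `C^∞`-small,
ν-dependent correction of ONE steady smooth force. -/
theorem tendstoUniformly_force {c : ℕ → (↥S → ℂ³)} {c₀ : ↥S → ℂ³} (hc : Tendsto c atTop (𝓝 c₀)) :
    TendstoUniformly (fun j => force S (c j)) (force S c₀) atTop := by
  have hcont : Continuous ↿(force S) := continuous_force_uncurry S
  have h := Continuous.tendstoUniformly (force S) hcont c₀
  intro v hv
  exact hc.eventually (h v hv)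

/-- **FROZEN DESIGN IS THE SUMMIT.**  If ONE coefficient vector `c⋆` is loud with fixed budgets along some `ν_j → 0`
(the convergent design of `denseLoudDesignerForces_iff_convergentDesign` taken CONSTANT), then `AnomalousDissipation`:
`f_{c⋆}` is smooth, solenoidal and mean-free, and each periodic classical orbit is a global Leray–Hopf solution from its
time-zero slice (`IsClassicalNSSolutionOn.isGlobalLerayHopf`, the tree's discharge of Robinson–Rodrigo–Sadowski 2016
Thm. 6.5).  [cite: RobinsonRodrigoSadowski2016, Thm 6.5] -/
theorem anomalousDissipation_of_constantDesign (hε : 0 < ε) (c₀ : ↥S → ℂ³)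
    (h : ∃ ν : ℕ → ℝ, (∀ j, 0 < ν j) ∧ Tendsto ν atTop (𝓝 0) ∧ ∀ j, LoudAt S E ε (ν j) c₀) :
    AnomalousDissipation := by
  obtain ⟨ν, hν, hν0, hLoud⟩ := h
  choose τ u p hτ hsol hper hEu hεu using hLoud
  exact anomalousDissipation_of_constantForces hε c₀
    ⟨ν, fun j => u j 0, u, hν, hν0, fun j => (hsol j).isGlobalLerayHopf, hEu, hεu⟩

/-- **THE FREEZING PRINCIPLE** — the exact residual between the crux and the summit: whenever every point of a non-empty
open set of designer forces is the limit of a loud convergent design with budgets `(E, ε)`, SOME point of that set carries a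
loud FROZEN (constant) design with the relaxed budgets `(2E, ε/2)`.  An asymptotic (ν → 0) force-stability statement for
loud bounded periodic dynamics; the route's rank-3 crux `RobustLoudUpgrade` + Baire is one way to obtain it, a uniform
persistence radius (§D13) another.  Not asserted. -/
def FreezingPrinciple : Prop :=
  ∀ (S : Finset (Fin 3 → ℤ)) (E ε : ℝ) (U : Set (↥S → ℂ³)), 0 < ε → IsOpen U → U.Nonempty →
    (∀ c₀ ∈ U, ∃ (c : ℕ → (↥S → ℂ³)) (ν : ℕ → ℝ),
      Tendsto c atTop (𝓝 c₀) ∧ (∀ j, 0 < ν j) ∧ Tendsto ν atTop (𝓝 0) ∧ ∀ j, LoudAt S E ε (ν j) (c j)) →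
    ∃ c₀ ∈ U, ∃ ν : ℕ → ℝ, (∀ j, 0 < ν j) ∧ Tendsto ν atTop (𝓝 0) ∧ ∀ j, LoudAt S (2 * E) (ε / 2) (ν j) c₀

/-- **crux → FreezingPrinciple → summit**: the crux decides the summit exactly modulo freezing of the design. -/
theorem anomalousDissipation_of_crux_of_freezing (h : DenseLoudDesignerForces) (hF : FreezingPrinciple) :
    AnomalousDissipation := by
  obtain ⟨S, -, E, ε, hε, U, hUo, hne, hconv⟩ := denseLoudDesignerForces_iff_convergentDesign.1 h ∅
  obtain ⟨c₀, -, ν, hν, hν0, hLoud⟩ := hF S E ε U hε hUo hne hconv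
  exact anomalousDissipation_of_constantDesign (by positivity) c₀ ⟨ν, hν, hν0, hLoud⟩

/-! ## §D13  Decomposition: loudness on a thin family ∧ a level-uniform persistence radius -/

/-- **Sub_A′ — THIN-FAMILY LOUDNESS**: for every stock `S₀` there are `S ⊇ S₀`, budgets and a non-empty ANCHOR FAMILY
`A ⊆ P_S` (no openness required: a symmetric slice, an explicit one-parameter family, …) inside which the loud forces are
dense at every level (`A ⊆ closure (A ∩ LOUD_j)`).  With `A` open this is the crux (`thinFamilyLoud_of_crux`). -/
def ThinFamilyLoud : Prop :=
  ∀ S₀ : Finset (Fin 3 → ℤ), ∃ S : Finset (Fin 3 → ℤ), S₀ ⊆ S ∧ ∃ (E ε : ℝ), 0 < ε ∧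
    ∃ A : Set (↥S → ℂ³), A.Nonempty ∧ ∀ j : ℕ, A ⊆ closure (A ∩ loudSet S E ε j)

/-- **Sub_B′ — UNIFORM PERSISTENCE RADIUS**: for every stock and budgets there is ONE radius `r > 0` such that at EVERY
level every loud force stays loud (budgets relaxed by 2) on the whole ball of radius `r` around it.  A ν-UNIFORM
force-robustness of loudness — far stronger than the route's per-level openness crux `RobustLoudUpgrade`. -/
def UniformPersistence : Prop :=
  ∀ (S : Finset (Fin 3 → ℤ)) (E ε : ℝ), 0 < ε → ∃ r : ℝ, 0 < r ∧ ∀ j : ℕ, ∀ c ∈ loudSet S E ε j,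
    Metric.ball c r ⊆ loudSet S (2 * E) (ε / 2) j

/-- Sub_A′ is NECESSARY (a window is an open anchor family: `U ∩ closure LOUD_j ⊆ closure (U ∩ LOUD_j)`). -/
theorem thinFamilyLoud_of_crux (h : DenseLoudDesignerForces) : ThinFamilyLoud := by
  rw [denseLoudDesignerForces_iff] at h
  intro S₀
  obtain ⟨S, hS, E, ε, hε, U, hUo, hne, hW⟩ := h S₀
  exact ⟨S, hS, E, ε, hε, U, hne, fun j c hc => hUo.inter_closure ⟨hc, hW j hc⟩⟩

/-- **Glue D13**: `Sub_A′ → Sub_B′ → crux` (budgets `(2E, ε/2)`; the window is the open `r/2`-thickening of the anchor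
family: a point within `r/2` of `A` is within `r/2 + r/2` of a loud force of `A`, hence loud with relaxed budgets). -/
theorem denseLoudDesignerForces_of_thin_of_uniformPersistence (hA : ThinFamilyLoud) (hB : UniformPersistence) :
    DenseLoudDesignerForces := by
  rw [denseLoudDesignerForces_iff]
  intro S₀
  obtain ⟨S, hS, E, ε, hε, A, ⟨a, ha⟩, hd⟩ := hA S₀
  obtain ⟨r, hr, hB'⟩ := hB S E ε hε
  refine ⟨S, hS, 2 * E, ε / 2, by positivity, Metric.thickening (r / 2) A, Metric.isOpen_thickening,
    ⟨a, Metric.self_subset_thickening (by positivity) A ha⟩, fun j x hx => subset_closure ?_⟩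
  rw [Metric.mem_thickening_iff] at hx
  obtain ⟨z, hzA, hxz⟩ := hx
  have hz : z ∈ closure (A ∩ loudSet S E ε j) := hd j hzA
  obtain ⟨c, ⟨-, hcL⟩, hzc⟩ := Metric.mem_closure_iff.1 hz (r / 2) (by positivity)
  refine hB' j c hcL ?_
  rw [Metric.mem_ball]
  calc dist x c ≤ dist x z + dist z c := dist_triangle x z c
    _ < r / 2 + r / 2 := add_lt_add hxz hzc
    _ = r := by ring

/-- A force lying in EVERY level's loud set carries a frozen loud design (`ν_j < 1/(j+1) → 0` by squeezing). -/
theorem frozen_of_forall_mem_loudSet {c₀ : ↥S → ℂ³} (h : ∀ j : ℕ, c₀ ∈ loudSet S E ε j) :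
    ∃ ν : ℕ → ℝ, (∀ j, 0 < ν j) ∧ Tendsto ν atTop (𝓝 0) ∧ ∀ j, LoudAt S E ε (ν j) c₀ := by
  choose ν hν hνj hL using h
  exact ⟨ν, hν, squeeze_zero (fun j => (hν j).le) (fun j => (hνj j).le) tendsto_one_div_add_atTop_nhds_zero_nat, hL⟩

/-- Uniform persistence FREEZES designs (§C): along a loud convergent design `c_j → c⋆`, for each level `m` some `c_j` is
both within `r` of `c⋆` and loud at level `m`, so `c⋆ ∈ LOUD_m(2E, ε/2)` for every `m` —
`UniformPersistence → FreezingPrinciple`.  (Hence, with §D13's glue, `ThinFamilyLoud ∧ UniformPersistence` already gives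
the SUMMIT, not just the crux: `anomalousDissipation_of_thin_of_uniformPersistence`.) -/
theorem freezingPrinciple_of_uniformPersistence (hB : UniformPersistence) : FreezingPrinciple := by
  intro S E ε U hε _hUo hne hconv
  obtain ⟨c₀, hc₀⟩ := hne
  obtain ⟨c, ν, hc, hν, hν0, hLoud⟩ := hconv c₀ hc₀
  obtain ⟨r, hr, hB'⟩ := hB S E ε hε
  refine ⟨c₀, hc₀, frozen_of_forall_mem_loudSet fun m => ?_⟩
  -- eventually `dist (c j) c₀ < r` and eventually `ν j < 1/(m+1)`
  have hev₁ : ∀ᶠ j in atTop, dist (c j) c₀ < r := (tendsto_iff_dist_tendsto_zero.1 hc).eventually (gt_mem_nhds hr)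
  have hev₂ : ∀ᶠ j in atTop, ν j < 1 / ((m : ℝ) + 1) := (tendsto_order.1 hν0).2 _ Nat.one_div_pos_of_nat
  obtain ⟨j, hj₁, hj₂⟩ := (hev₁.and hev₂).exists
  have hmem : c j ∈ loudSet S E ε m := ⟨ν j, hν j, hj₂, hLoud j⟩
  refine hB' m (c j) hmem ?_
  rw [Metric.mem_ball, dist_comm]
  exact hj₁

/-- `Sub_A′ ∧ Sub_B′` give the SUMMIT outright (glue D13 + freezing + §C). -/
theorem anomalousDissipation_of_thin_of_uniformPersistence (hA : ThinFamilyLoud) (hB : UniformPersistence) :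
    AnomalousDissipation :=
  anomalousDissipation_of_crux_of_freezing (denseLoudDesignerForces_of_thin_of_uniformPersistence hA hB)
    (freezingPrinciple_of_uniformPersistence hB)

/-! ## §S⁺_σ  Strengthen: uniformly Onsager-bounded witnesses -/

/-- Loud forces at level `j` whose witness is bounded by `M` in `B^σ_{3,∞}(T³)` AT EVERY TIME (Nikol'skii–Besov class of
`Literature.Analysis.FunctionSpaces.BesovDifference`, the one entering the Drivas–Eyink barrier; for a smooth periodic orbit the
supremum over time is finite anyway — the content is its uniformity in the level).  The pointwise-in-time form is chosen so that
every unit time window inherits BOTH a uniform `L³_t B^σ_{3,∞}` bound AND a uniform `B^σ_{2,∞}` bound on its initial slice, the two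
solution-side hypotheses of `DrivasEyink2019_lemma1_measurable`. -/
def onsagerLoudSet (S : Finset (Fin 3 → ℤ)) (E ε σ : ℝ) (M : ℝ≥0) (j : ℕ) : Set (↥S → ℂ³) :=
  {c | ∃ ν : ℝ, 0 < ν ∧ ν < 1 / ((j : ℝ) + 1) ∧
    ∃ (τ : ℝ) (u : ℝ → 𝕋³ → ℝ³) (p : ℝ → 𝕋³ → ℝ), 0 < τ ∧
      Torus.IsClassicalNSSolutionOn Set.univ ν (fun _ => force S c) u p ∧
      Function.Periodic u τ ∧ meanEnergy u ≤ E ∧ ε ≤ meanDissipation ν u ∧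
      ∀ t : ℝ, MemBesovSup σ 3 (u t) volume ∧ eBesovSupNorm σ 3 (u t) volume ≤ M}

/-- **S⁺_σ — DENSE LOUD DESIGNER FORCES WITH UNIFORMLY `B^σ_{3,∞}`-BOUNDED WITNESSES**: the crux with one Onsager bound
`M` for all levels and all times.  `σ > 1/3`: empty at large levels (Drivas–Eyink on a loud unit window; census §Strengthen);
`σ = 1/3`: the K41-consistent strengthening (compactness of witness families, Duchon–Robert limits with `D(u) = ε`);
`σ < 1/3`: weaker constraint, same status. -/
def DenseLoudOnsagerBoundedForces (σ : ℝ) : Prop :=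
  ∀ S₀ : Finset (Fin 3 → ℤ), ∃ S : Finset (Fin 3 → ℤ), S₀ ⊆ S ∧ ∃ (E ε : ℝ) (M : ℝ≥0), 0 < ε ∧
    ∃ U : Set (↥S → ℂ³), IsOpen U ∧ U.Nonempty ∧ ∀ j : ℕ, U ⊆ closure (onsagerLoudSet S E ε σ M j)

theorem onsagerLoudSet_subset_loudSet (S : Finset (Fin 3 → ℤ)) (E ε σ : ℝ) (M : ℝ≥0) (j : ℕ) :
    onsagerLoudSet S E ε σ M j ⊆ loudSet S E ε j := by
  rintro c ⟨ν, hν, hνj, τ, u, p, hτ, hsol, hper, hEu, hεu, -⟩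
  exact ⟨ν, hν, hνj, τ, u, p, hτ, hsol, hper, hEu, hεu⟩

/-- Adapter `S⁺_σ → crux`. -/
theorem denseLoudDesignerForces_of_onsagerBounded (σ : ℝ) (h : DenseLoudOnsagerBoundedForces σ) :
    DenseLoudDesignerForces := by
  rw [denseLoudDesignerForces_iff]
  intro S₀
  obtain ⟨S, hS, E, ε, M, hε, U, hUo, hne, hW⟩ := h S₀
  exact ⟨S, hS, E, ε, hε, U, hUo, hne, fun j =>
    (hW j).trans (closure_mono (onsagerLoudSet_subset_loudSet S E ε σ M j))⟩

end Summit.AnomalousDissipation.AnomalousDissipation.Cruxes.DenseLoudDesignerForces.StrategistCensusR1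

end
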